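import Mathlib.LinearAlgebra.Matrix.Determinant.Basic
import Mathlib.LinearAlgebra.Matrix.Notation
import Mathlib.RingTheory.Ideal.Operations
import Mathlib.RingTheory.Ideal.Span
import Mathlib.Tactic.Ring
import Mathlib.Tactic.FinCases
import HarnessLib

/-!
# `𝔮⁴ ⊆ 𝔔`: the 70 generators of `(x², y, u, t, z)⁴` lie in the one-block determinantal ideal `𝔔 = (x⁸, x⁶I₁, x⁴I₂, x²I₃, I₄)` of `W′`
# (kernel piece (C) of LEMMA N♭; crux `FInjectiveMacaulayfication` stmt-ResolutionOfSingularities-15315, chain w45a, F-centre census Tier-2;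
# res-L1-w45a-plan-1 R17.14 (3); seat res-L1-w45a-lead-1 g8; certificates = kit job j301314 (35 s; evidence on the item); scope `Lines/LEMMA-N-SCOPE.md`)

[OURS · L1 W4.5a] Support file (`--supports stmt-ResolutionOfSingularities-15315 --as helper`); replaces the role of NO printed item; NOT a statement
of any manuscript; def-free; AI-written (AI review is weaker than expert review).

`W′ = z·I₈ + N_g` is the one 8×8 block of the coordinate matrix of `F_*A₀`, `A₀ = k[x,y,u,t,z]/(z²+x⁴z+y³+u³+t³)`, char 2 (file `…NormBlockMatrix`, same
hypothesis `hW : W = !![…]`, index order `∅,y,u,t,yu,yt,ut,yut`); `I_j` = the ideal of its `j × j` minors. The one-block Frobenius norm is `x⁻⁸·𝔔`,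
`𝔔 := (x⁸) + x⁶I₁ + x⁴I₂ + x²I₃ + I₄` (after Jacobi duality, file `…JacobiMinor`). THIS FILE: **`pow_four_span_le : (x², y, u, t, z)⁴ ≤ 𝔔`** over ANY
commutative ring with `2 = 0` — remarkably the inclusion holds already in the POLYNOMIAL ring, with no multiple of `f` (kit job j301314: GF(2) linear algebra in
cofactor degree ≤ 2; 93 cofactor monomials, 87 distinct minors of size ≤ 4). Each of the 70 monomial generators `μ` is certified by an INTEGER identity
`μ = Σ cofᵢ·genᵢ + 2·r` closed by `simp` (Laplace expansion of the explicit minors) and `ring`; the reverse inclusion `𝔔 ⊆ 𝔮⁴` is `det_submatrix_mem_pow`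
of `…NormBlockMatrix`. Together: **`𝔔 = 𝔮⁴` globally** (idea-1 FB5-r1 §3.3 certified it locally at the vertex; tri-2 g14 re-ran the engine).
[computation OURS, kit j301314; folklore linear algebra]
-/

-- single-problem summit: the doubled namespace component is forced
set_option linter.dupNamespace false

namespace Summit.ResolutionOfSingularities.ResolutionOfSingularities.Theorems.FInjectiveMacaulayfication.NormBlockCerts

open Matrix

variable {R : Type*} [CommRing R]

/-- **Laplace expansion of a `4 × 4` determinant along the first row, with the `3 × 3` cofactors written out** (robust, `decide`-free evaluation of
`Fin.succAbove`). [folklore] -/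
theorem det_fin_four' (M : Matrix (Fin 4) (Fin 4) R) : M.det =
    M 0 0 * (M 1 1 * M 2 2 * M 3 3 - M 1 1 * M 2 3 * M 3 2 - M 1 2 * M 2 1 * M 3 3 + M 1 2 * M 2 3 * M 3 1 + M 1 3 * M 2 1 * M 3 2 - M 1 3 * M 2 2 * M 3 1)
    - M 0 1 * (M 1 0 * M 2 2 * M 3 3 - M 1 0 * M 2 3 * M 3 2 - M 1 2 * M 2 0 * M 3 3 + M 1 2 * M 2 3 * M 3 0 + M 1 3 * M 2 0 * M 3 2 - M 1 3 * M 2 2 * M 3 0)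
    + M 0 2 * (M 1 0 * M 2 1 * M 3 3 - M 1 0 * M 2 3 * M 3 1 - M 1 1 * M 2 0 * M 3 3 + M 1 1 * M 2 3 * M 3 0 + M 1 3 * M 2 0 * M 3 1 - M 1 3 * M 2 1 * M 3 0)
    - M 0 3 * (M 1 0 * M 2 1 * M 3 2 - M 1 0 * M 2 2 * M 3 1 - M 1 1 * M 2 0 * M 3 2 + M 1 1 * M 2 2 * M 3 0 + M 1 2 * M 2 0 * M 3 1 - M 1 2 * M 2 1 * M 3 0) := by
  have d0 : (M.submatrix Fin.succ (Fin.succAbove 0)).det =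
      M 1 1 * M 2 2 * M 3 3 - M 1 1 * M 2 3 * M 3 2 - M 1 2 * M 2 1 * M 3 3 + M 1 2 * M 2 3 * M 3 1 + M 1 3 * M 2 1 * M 3 2 - M 1 3 * M 2 2 * M 3 1 := by
    rw [Matrix.det_fin_three]; rfl
  have d1 : (M.submatrix Fin.succ (Fin.succAbove 1)).det =
      M 1 0 * M 2 2 * M 3 3 - M 1 0 * M 2 3 * M 3 2 - M 1 2 * M 2 0 * M 3 3 + M 1 2 * M 2 3 * M 3 0 + M 1 3 * M 2 0 * M 3 2 - M 1 3 * M 2 2 * M 3 0 := by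
    rw [Matrix.det_fin_three]; rfl
  have d2 : (M.submatrix Fin.succ (Fin.succAbove 2)).det =
      M 1 0 * M 2 1 * M 3 3 - M 1 0 * M 2 3 * M 3 1 - M 1 1 * M 2 0 * M 3 3 + M 1 1 * M 2 3 * M 3 0 + M 1 3 * M 2 0 * M 3 1 - M 1 3 * M 2 1 * M 3 0 := by
    rw [Matrix.det_fin_three]; rfl
  have d3 : (M.submatrix Fin.succ (Fin.succAbove 3)).det =
      M 1 0 * M 2 1 * M 3 2 - M 1 0 * M 2 2 * M 3 1 - M 1 1 * M 2 0 * M 3 2 + M 1 1 * M 2 2 * M 3 0 + M 1 2 * M 2 0 * M 3 1 - M 1 2 * M 2 1 * M 3 0 := by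
    rw [Matrix.det_fin_three]; rfl
  rw [Matrix.det_succ_row_zero, Fin.sum_univ_four, d0, d1, d2, d3]
  simp only [Fin.val_zero, Fin.val_one, Fin.val_two, pow_zero, pow_one, one_mul]
  have h3 : ((3 : Fin 4) : ℕ) = 3 := rfl
  rw [h3]
  ring

set_option maxHeartbeats 4000000 in
-- seventy certified identities, each a Laplace expansion of ≤ 4 explicit minors of size ≤ 4 followed by `ring`
/-- **`(x², y, u, t, z)⁴ ≤ 𝔔 = (x⁸, x⁶·entries, x⁴·2-minors, x²·3-minors, 4-minors of W′)`** over any commutative ring with `2 = 0`, by 70 integer-lifted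
certificates (kit j301314). The generating set of `𝔔` allows arbitrary (also non-injective) row/column selections — those only add zero or repeated minors.
[computation OURS] -/
theorem pow_four_span_le (h2 : (2 : R) = 0) (x y u t z : R) (W : Matrix (Fin 8) (Fin 8) R)
    (hW : W = !![z, y, u, t, 0, 0, 0, 0;
      y ^ 2, z, 0, 0, u, t, 0, 0;
      u ^ 2, 0, z, 0, y, 0, t, 0;
      t ^ 2, 0, 0, z, 0, y, u, 0;
      0, u ^ 2, y ^ 2, 0, z, 0, 0, t;
      0, t ^ 2, 0, y ^ 2, 0, z, 0, u;
      0, 0, t ^ 2, u ^ 2, 0, 0, z, y;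
      0, 0, 0, 0, t ^ 2, u ^ 2, y ^ 2, z]) :
    Ideal.span ({x ^ 2, y, u, t, z} : Set R) ^ 4 ≤
      Ideal.span {d : R | d = x ^ 8 ∨ (∃ i j : Fin 8, d = x ^ 6 * W i j) ∨ (∃ r c : Fin 2 → Fin 8, d = x ^ 4 * (W.submatrix r c).det) ∨
        (∃ r c : Fin 3 → Fin 8, d = x ^ 2 * (W.submatrix r c).det) ∨ (∃ r c : Fin 4 → Fin 8, d = (W.submatrix r c).det)} := by
  set Q : Ideal R := Ideal.span {d : R | d = x ^ 8 ∨ (∃ i j : Fin 8, d = x ^ 6 * W i j) ∨ (∃ r c : Fin 2 → Fin 8, d = x ^ 4 * (W.submatrix r c).det) ∨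
        (∃ r c : Fin 3 → Fin 8, d = x ^ 2 * (W.submatrix r c).det) ∨ (∃ r c : Fin 4 → Fin 8, d = (W.submatrix r c).det)} with hQ
  have gx8 : x ^ 8 ∈ Q := Ideal.subset_span (Or.inl rfl)
  have g1 : ∀ i j : Fin 8, x ^ 6 * W i j ∈ Q := fun i j => Ideal.subset_span (Or.inr (Or.inl ⟨i, j, rfl⟩))
  have g2 : ∀ r c : Fin 2 → Fin 8, x ^ 4 * (W.submatrix r c).det ∈ Q := fun r c => Ideal.subset_span (Or.inr (Or.inr (Or.inl ⟨r, c, rfl⟩)))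
  have g3 : ∀ r c : Fin 3 → Fin 8, x ^ 2 * (W.submatrix r c).det ∈ Q := fun r c => Ideal.subset_span (Or.inr (Or.inr (Or.inr (Or.inl ⟨r, c, rfl⟩))))
  have g4 : ∀ r c : Fin 4 → Fin 8, (W.submatrix r c).det ∈ Q := fun r c => Ideal.subset_span (Or.inr (Or.inr (Or.inr (Or.inr ⟨r, c, rfl⟩))))
  have m0 : z * z * z * z ∈ Q := by
    have e : z * z * z * z = 1 * ((W.submatrix ![0, 1, 2, 4] ![0, 1, 2, 4]).det) + 1 * ((W.submatrix ![0, 1, 3, 5] ![0, 1, 3, 5]).det) + 1 * ((W.submatrix ![0, 2, 3, 6] ![0, 2, 3, 6]).det) + 2 * ((-1) * z ^ 4 + (2) * t ^ 3 * z ^ 2 + (-1) * t ^ 6 + (2) * u ^ 3 * z ^ 2 + u ^ 3 * t ^ 3 + (-1) * u ^ 6 + (2) * y ^ 3 * z ^ 2 + y ^ 3 * t ^ 3 + y ^ 3 * u ^ 3 + (-1) * y ^ 6) := by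
      subst hW; simp [det_fin_four']; ring
    rw [e, h2, zero_mul, add_zero]; exact (Q.add_mem (Q.add_mem (Q.mul_mem_left _ (g4 ![0, 1, 2, 4] ![0, 1, 2, 4])) (Q.mul_mem_left _ (g4 ![0, 1, 3, 5] ![0, 1, 3, 5]))) (Q.mul_mem_left _ (g4 ![0, 2, 3, 6] ![0, 2, 3, 6])))
  have m1 : t * z * z * z ∈ Q := by
    have e : t * z * z * z = 1 * ((W.submatrix ![0, 1, 2, 4] ![0, 1, 2, 7]).det) + 1 * ((W.submatrix ![0, 1, 2, 5] ![0, 1, 3, 7]).det) + 1 * ((W.submatrix ![0, 1, 2, 6] ![0, 2, 3, 7]).det) + 2 * (u ^ 3 * t * z) := by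
      subst hW; simp [det_fin_four']; ring
    rw [e, h2, zero_mul, add_zero]; exact (Q.add_mem (Q.add_mem (Q.mul_mem_left _ (g4 ![0, 1, 2, 4] ![0, 1, 2, 7])) (Q.mul_mem_left _ (g4 ![0, 1, 2, 5] ![0, 1, 3, 7]))) (Q.mul_mem_left _ (g4 ![0, 1, 2, 6] ![0, 2, 3, 7])))
  have m2 : t * t * z * z ∈ Q := by
    have e : t * t * z * z = 1 * ((W.submatrix ![0, 1, 2, 4] ![0, 4, 5, 6]).det) + 2 * (0) := by
      subst hW; simp [det_fin_four']; ring
    rw [e, h2, zero_mul, add_zero]; exact (Q.mul_mem_left _ (g4 ![0, 1, 2, 4] ![0, 4, 5, 6]))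
  have m3 : t * t * t * z ∈ Q := by
    have e : t * t * t * z = 1 * ((W.submatrix ![0, 1, 2, 4] ![0, 5, 6, 7]).det) + 2 * (0) := by
      subst hW; simp [det_fin_four']; ring
    rw [e, h2, zero_mul, add_zero]; exact (Q.mul_mem_left _ (g4 ![0, 1, 2, 4] ![0, 5, 6, 7]))
  have m4 : t * t * t * t ∈ Q := by
    have e : t * t * t * t = 1 * ((W.submatrix ![0, 1, 2, 4] ![3, 5, 6, 7]).det) + 2 * (0) := by
      subst hW; simp [det_fin_four']; ring
    rw [e, h2, zero_mul, add_zero]; exact (Q.mul_mem_left _ (g4 ![0, 1, 2, 4] ![3, 5, 6, 7]))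
  have m5 : u * z * z * z ∈ Q := by
    have e : u * z * z * z = t * ((W.submatrix ![0, 1, 2, 4] ![0, 4, 6, 7]).det) + 1 * ((W.submatrix ![0, 1, 3, 5] ![0, 1, 3, 7]).det) + 1 * ((W.submatrix ![0, 1, 3, 6] ![0, 2, 3, 7]).det) + 2 * (y ^ 3 * u * z) := by
      subst hW; simp [det_fin_four']; ring
    rw [e, h2, zero_mul, add_zero]; exact (Q.add_mem (Q.add_mem (Q.mul_mem_left _ (g4 ![0, 1, 2, 4] ![0, 4, 6, 7])) (Q.mul_mem_left _ (g4 ![0, 1, 3, 5] ![0, 1, 3, 7]))) (Q.mul_mem_left _ (g4 ![0, 1, 3, 6] ![0, 2, 3, 7])))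
  have m6 : u * t * z * z ∈ Q := by
    have e : u * t * z * z = 1 * ((W.submatrix ![0, 1, 2, 4] ![0, 2, 4, 7]).det) + 1 * ((W.submatrix ![0, 1, 2, 5] ![0, 1, 6, 7]).det) + 1 * ((W.submatrix ![0, 1, 2, 5] ![0, 2, 5, 7]).det) + 2 * (u * t * z ^ 2 + (-1) * u ^ 4 * t + y ^ 3 * u * t) := by
      subst hW; simp [det_fin_four']; ring
    rw [e, h2, zero_mul, add_zero]; exact (Q.add_mem (Q.add_mem (Q.mul_mem_left _ (g4 ![0, 1, 2, 4] ![0, 2, 4, 7])) (Q.mul_mem_left _ (g4 ![0, 1, 2, 5] ![0, 1, 6, 7]))) (Q.mul_mem_left _ (g4 ![0, 1, 2, 5] ![0, 2, 5, 7])))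
  have m7 : u * t * t * z ∈ Q := by
    have e : u * t * t * z = 1 * ((W.submatrix ![0, 1, 2, 4] ![0, 4, 6, 7]).det) + 2 * (0) := by
      subst hW; simp [det_fin_four']; ring
    rw [e, h2, zero_mul, add_zero]; exact (Q.mul_mem_left _ (g4 ![0, 1, 2, 4] ![0, 4, 6, 7]))
  have m8 : u * t * t * t ∈ Q := by
    have e : u * t * t * t = 1 * ((W.submatrix ![0, 1, 2, 4] ![2, 5, 6, 7]).det) + 2 * (0) := by
      subst hW; simp [det_fin_four']; ring
    rw [e, h2, zero_mul, add_zero]; exact (Q.mul_mem_left _ (g4 ![0, 1, 2, 4] ![2, 5, 6, 7]))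
  have m9 : u * u * z * z ∈ Q := by
    have e : u * u * z * z = 1 * ((W.submatrix ![0, 1, 2, 4] ![0, 3, 5, 7]).det) + 1 * ((W.submatrix ![0, 1, 3, 5] ![0, 1, 6, 7]).det) + 1 * ((W.submatrix ![0, 1, 3, 5] ![0, 2, 5, 7]).det) + 2 * ((-1) * u ^ 2 * t ^ 3 + y ^ 3 * u ^ 2) := by
      subst hW; simp [det_fin_four']; ring
    rw [e, h2, zero_mul, add_zero]; exact (Q.add_mem (Q.add_mem (Q.mul_mem_left _ (g4 ![0, 1, 2, 4] ![0, 3, 5, 7])) (Q.mul_mem_left _ (g4 ![0, 1, 3, 5] ![0, 1, 6, 7]))) (Q.mul_mem_left _ (g4 ![0, 1, 3, 5] ![0, 2, 5, 7])))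
  have m10 : u * u * t * z ∈ Q := by
    have e : u * u * t * z = 1 * ((W.submatrix ![0, 1, 2, 5] ![0, 4, 6, 7]).det) + 2 * (0) := by
      subst hW; simp [det_fin_four']; ring
    rw [e, h2, zero_mul, add_zero]; exact (Q.mul_mem_left _ (g4 ![0, 1, 2, 5] ![0, 4, 6, 7]))
  have m11 : u * u * t * t ∈ Q := by
    have e : u * u * t * t = 1 * ((W.submatrix ![0, 1, 2, 4] ![2, 4, 6, 7]).det) + 2 * (0) := by
      subst hW; simp [det_fin_four']; ring
    rw [e, h2, zero_mul, add_zero]; exact (Q.mul_mem_left _ (g4 ![0, 1, 2, 4] ![2, 4, 6, 7]))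
  have m12 : u * u * u * z ∈ Q := by
    have e : u * u * u * z = 1 * ((W.submatrix ![0, 1, 3, 5] ![0, 4, 6, 7]).det) + 2 * (0) := by
      subst hW; simp [det_fin_four']; ring
    rw [e, h2, zero_mul, add_zero]; exact (Q.mul_mem_left _ (g4 ![0, 1, 3, 5] ![0, 4, 6, 7]))
  have m13 : u * u * u * t ∈ Q := by
    have e : u * u * u * t = 1 * ((W.submatrix ![0, 1, 2, 5] ![2, 4, 6, 7]).det) + 2 * (0) := by
      subst hW; simp [det_fin_four']; ring
    rw [e, h2, zero_mul, add_zero]; exact (Q.mul_mem_left _ (g4 ![0, 1, 2, 5] ![2, 4, 6, 7]))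
  have m14 : u * u * u * u ∈ Q := by
    have e : u * u * u * u = 1 * ((W.submatrix ![0, 1, 3, 5] ![2, 4, 6, 7]).det) + 2 * (0) := by
      subst hW; simp [det_fin_four']; ring
    rw [e, h2, zero_mul, add_zero]; exact (Q.mul_mem_left _ (g4 ![0, 1, 3, 5] ![2, 4, 6, 7]))
  have m15 : y * z * z * z ∈ Q := by
    have e : y * z * z * z = t * ((W.submatrix ![0, 1, 2, 4] ![0, 4, 5, 7]).det) + u * ((W.submatrix ![0, 1, 3, 5] ![0, 4, 5, 7]).det) + 1 * ((W.submatrix ![0, 2, 3, 6] ![0, 2, 3, 7]).det) + 2 * (y * t ^ 3 * z) := by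
      subst hW; simp [det_fin_four']; ring
    rw [e, h2, zero_mul, add_zero]; exact (Q.add_mem (Q.add_mem (Q.mul_mem_left _ (g4 ![0, 1, 2, 4] ![0, 4, 5, 7])) (Q.mul_mem_left _ (g4 ![0, 1, 3, 5] ![0, 4, 5, 7]))) (Q.mul_mem_left _ (g4 ![0, 2, 3, 6] ![0, 2, 3, 7])))
  have m16 : y * t * z * z ∈ Q := by
    have e : y * t * z * z = 1 * ((W.submatrix ![0, 1, 2, 5] ![0, 1, 5, 7]).det) + 1 * ((W.submatrix ![0, 1, 2, 6] ![0, 2, 5, 7]).det) + 2 * (y * t * z ^ 2 + (-1) * y * u ^ 3 * t) := by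
      subst hW; simp [det_fin_four']; ring
    rw [e, h2, zero_mul, add_zero]; exact (Q.add_mem (Q.mul_mem_left _ (g4 ![0, 1, 2, 5] ![0, 1, 5, 7])) (Q.mul_mem_left _ (g4 ![0, 1, 2, 6] ![0, 2, 5, 7])))
  have m17 : y * t * t * z ∈ Q := by
    have e : y * t * t * z = 1 * ((W.submatrix ![0, 1, 2, 4] ![0, 4, 5, 7]).det) + 2 * (y * t ^ 2 * z) := by
      subst hW; simp [det_fin_four']; ring
    rw [e, h2, zero_mul, add_zero]; exact (Q.mul_mem_left _ (g4 ![0, 1, 2, 4] ![0, 4, 5, 7]))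
  have m18 : y * t * t * t ∈ Q := by
    have e : y * t * t * t = 1 * ((W.submatrix ![0, 1, 2, 4] ![1, 5, 6, 7]).det) + 2 * (0) := by
      subst hW; simp [det_fin_four']; ring
    rw [e, h2, zero_mul, add_zero]; exact (Q.mul_mem_left _ (g4 ![0, 1, 2, 4] ![1, 5, 6, 7]))
  have m19 : y * u * z * z ∈ Q := by
    have e : y * u * z * z = 1 * ((W.submatrix ![0, 1, 3, 5] ![0, 1, 5, 7]).det) + 1 * ((W.submatrix ![0, 1, 3, 6] ![0, 2, 5, 7]).det) + 2 * ((-1) * y * u * t ^ 3 + y ^ 4 * u) := by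
      subst hW; simp [det_fin_four']; ring
    rw [e, h2, zero_mul, add_zero]; exact (Q.add_mem (Q.mul_mem_left _ (g4 ![0, 1, 3, 5] ![0, 1, 5, 7])) (Q.mul_mem_left _ (g4 ![0, 1, 3, 6] ![0, 2, 5, 7])))
  have m20 : y * u * t * z ∈ Q := by
    have e : y * u * t * z = 1 * ((W.submatrix ![0, 1, 2, 5] ![0, 4, 5, 7]).det) + 2 * (y * u * t * z) := by
      subst hW; simp [det_fin_four']; ring
    rw [e, h2, zero_mul, add_zero]; exact (Q.mul_mem_left _ (g4 ![0, 1, 2, 5] ![0, 4, 5, 7]))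
  have m21 : y * u * t * t ∈ Q := by
    have e : y * u * t * t = 1 * ((W.submatrix ![0, 1, 2, 4] ![1, 4, 6, 7]).det) + 2 * (0) := by
      subst hW; simp [det_fin_four']; ring
    rw [e, h2, zero_mul, add_zero]; exact (Q.mul_mem_left _ (g4 ![0, 1, 2, 4] ![1, 4, 6, 7]))
  have m22 : y * u * u * z ∈ Q := by
    have e : y * u * u * z = 1 * ((W.submatrix ![0, 1, 3, 5] ![0, 4, 5, 7]).det) + 2 * (0) := by
      subst hW; simp [det_fin_four']; ring
    rw [e, h2, zero_mul, add_zero]; exact (Q.mul_mem_left _ (g4 ![0, 1, 3, 5] ![0, 4, 5, 7]))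
  have m23 : y * u * u * t ∈ Q := by
    have e : y * u * u * t = 1 * ((W.submatrix ![0, 1, 2, 5] ![1, 4, 6, 7]).det) + 2 * (0) := by
      subst hW; simp [det_fin_four']; ring
    rw [e, h2, zero_mul, add_zero]; exact (Q.mul_mem_left _ (g4 ![0, 1, 2, 5] ![1, 4, 6, 7]))
  have m24 : y * u * u * u ∈ Q := by
    have e : y * u * u * u = 1 * ((W.submatrix ![0, 1, 3, 5] ![1, 4, 6, 7]).det) + 2 * (0) := by
      subst hW; simp [det_fin_four']; ring
    rw [e, h2, zero_mul, add_zero]; exact (Q.mul_mem_left _ (g4 ![0, 1, 3, 5] ![1, 4, 6, 7]))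
  have m25 : y * y * z * z ∈ Q := by
    have e : y * y * z * z = 1 * ((W.submatrix ![0, 1, 3, 5] ![0, 2, 6, 7]).det) + 1 * ((W.submatrix ![0, 2, 3, 6] ![0, 2, 5, 7]).det) + 2 * (y ^ 2 * u ^ 3) := by
      subst hW; simp [det_fin_four']; ring
    rw [e, h2, zero_mul, add_zero]; exact (Q.add_mem (Q.mul_mem_left _ (g4 ![0, 1, 3, 5] ![0, 2, 6, 7])) (Q.mul_mem_left _ (g4 ![0, 2, 3, 6] ![0, 2, 5, 7])))
  have m26 : y * y * t * z ∈ Q := by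
    have e : y * y * t * z = 1 * ((W.submatrix ![0, 1, 2, 6] ![0, 4, 5, 7]).det) + 2 * (y ^ 2 * t * z) := by
      subst hW; simp [det_fin_four']; ring
    rw [e, h2, zero_mul, add_zero]; exact (Q.mul_mem_left _ (g4 ![0, 1, 2, 6] ![0, 4, 5, 7]))
  have m27 : y * y * t * t ∈ Q := by
    have e : y * y * t * t = 1 * ((W.submatrix ![0, 1, 2, 4] ![1, 4, 5, 7]).det) + 2 * (y ^ 2 * t ^ 2) := by
      subst hW; simp [det_fin_four']; ring
    rw [e, h2, zero_mul, add_zero]; exact (Q.mul_mem_left _ (g4 ![0, 1, 2, 4] ![1, 4, 5, 7]))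
  have m28 : y * y * u * z ∈ Q := by
    have e : y * y * u * z = 1 * ((W.submatrix ![0, 1, 3, 6] ![0, 4, 5, 7]).det) + 2 * (0) := by
      subst hW; simp [det_fin_four']; ring
    rw [e, h2, zero_mul, add_zero]; exact (Q.mul_mem_left _ (g4 ![0, 1, 3, 6] ![0, 4, 5, 7]))
  have m29 : y * y * u * t ∈ Q := by
    have e : y * y * u * t = 1 * ((W.submatrix ![0, 1, 2, 5] ![1, 4, 5, 7]).det) + 2 * (y ^ 2 * u * t) := by
      subst hW; simp [det_fin_four']; ring
    rw [e, h2, zero_mul, add_zero]; exact (Q.mul_mem_left _ (g4 ![0, 1, 2, 5] ![1, 4, 5, 7]))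
  have m30 : y * y * u * u ∈ Q := by
    have e : y * y * u * u = 1 * ((W.submatrix ![0, 1, 3, 5] ![1, 4, 5, 7]).det) + 2 * (0) := by
      subst hW; simp [det_fin_four']; ring
    rw [e, h2, zero_mul, add_zero]; exact (Q.mul_mem_left _ (g4 ![0, 1, 3, 5] ![1, 4, 5, 7]))
  have m31 : y * y * y * z ∈ Q := by
    have e : y * y * y * z = 1 * ((W.submatrix ![0, 2, 3, 6] ![0, 4, 5, 7]).det) + 2 * (0) := by
      subst hW; simp [det_fin_four']; ring
    rw [e, h2, zero_mul, add_zero]; exact (Q.mul_mem_left _ (g4 ![0, 2, 3, 6] ![0, 4, 5, 7]))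
  have m32 : y * y * y * t ∈ Q := by
    have e : y * y * y * t = 1 * ((W.submatrix ![0, 1, 2, 6] ![1, 4, 5, 7]).det) + 2 * (y ^ 3 * t) := by
      subst hW; simp [det_fin_four']; ring
    rw [e, h2, zero_mul, add_zero]; exact (Q.mul_mem_left _ (g4 ![0, 1, 2, 6] ![1, 4, 5, 7]))
  have m33 : y * y * y * u ∈ Q := by
    have e : y * y * y * u = 1 * ((W.submatrix ![0, 1, 3, 6] ![1, 4, 5, 7]).det) + 2 * (0) := by
      subst hW; simp [det_fin_four']; ring
    rw [e, h2, zero_mul, add_zero]; exact (Q.mul_mem_left _ (g4 ![0, 1, 3, 6] ![1, 4, 5, 7]))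
  have m34 : y * y * y * y ∈ Q := by
    have e : y * y * y * y = 1 * ((W.submatrix ![0, 2, 3, 6] ![1, 4, 5, 7]).det) + 2 * (0) := by
      subst hW; simp [det_fin_four']; ring
    rw [e, h2, zero_mul, add_zero]; exact (Q.mul_mem_left _ (g4 ![0, 2, 3, 6] ![1, 4, 5, 7]))
  have m35 : x ^ 2 * z * z * z ∈ Q := by
    have e : x ^ 2 * z * z * z = 1 * (x ^ 2 * (W.submatrix ![0, 1, 2] ![0, 1, 2]).det) + 1 * (x ^ 2 * (W.submatrix ![0, 1, 3] ![0, 1, 3]).det) + 1 * (x ^ 2 * (W.submatrix ![0, 2, 3] ![0, 2, 3]).det) + 2 * ((-1) * x ^ 2 * z ^ 3 + x ^ 2 * t ^ 3 * z + x ^ 2 * u ^ 3 * z + x ^ 2 * y ^ 3 * z) := by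
      subst hW; simp [Matrix.det_fin_three]; ring
    rw [e, h2, zero_mul, add_zero]; exact (Q.add_mem (Q.add_mem (Q.mul_mem_left _ (g3 ![0, 1, 2] ![0, 1, 2])) (Q.mul_mem_left _ (g3 ![0, 1, 3] ![0, 1, 3]))) (Q.mul_mem_left _ (g3 ![0, 2, 3] ![0, 2, 3])))
  have m36 : x ^ 2 * t * z * z ∈ Q := by
    have e : x ^ 2 * t * z * z = 1 * (x ^ 2 * (W.submatrix ![0, 1, 2] ![1, 2, 3]).det) + 2 * (0) := by
      subst hW; simp [Matrix.det_fin_three]; ring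
    rw [e, h2, zero_mul, add_zero]; exact (Q.mul_mem_left _ (g3 ![0, 1, 2] ![1, 2, 3]))
  have m37 : x ^ 2 * t * t * z ∈ Q := by
    have e : x ^ 2 * t * t * z = 1 * (x ^ 2 * (W.submatrix ![0, 1, 2] ![0, 5, 6]).det) + 2 * (0) := by
      subst hW; simp [Matrix.det_fin_three]; ring
    rw [e, h2, zero_mul, add_zero]; exact (Q.mul_mem_left _ (g3 ![0, 1, 2] ![0, 5, 6]))
  have m38 : x ^ 2 * t * t * t ∈ Q := by
    have e : x ^ 2 * t * t * t = 1 * (x ^ 2 * (W.submatrix ![0, 1, 2] ![3, 5, 6]).det) + 2 * (0) := by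
      subst hW; simp [Matrix.det_fin_three]; ring
    rw [e, h2, zero_mul, add_zero]; exact (Q.mul_mem_left _ (g3 ![0, 1, 2] ![3, 5, 6]))
  have m39 : x ^ 2 * u * z * z ∈ Q := by
    have e : x ^ 2 * u * z * z = t * (x ^ 2 * (W.submatrix ![0, 1, 2] ![2, 5, 6]).det) + 1 * (x ^ 2 * (W.submatrix ![0, 1, 3] ![0, 1, 6]).det) + 1 * (x ^ 2 * (W.submatrix ![0, 1, 3] ![0, 2, 5]).det) + 2 * ((-1) * x ^ 2 * u * t ^ 3 + x ^ 2 * y ^ 3 * u) := by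
      subst hW; simp [Matrix.det_fin_three]; ring
    rw [e, h2, zero_mul, add_zero]; exact (Q.add_mem (Q.add_mem (Q.mul_mem_left _ (g3 ![0, 1, 2] ![2, 5, 6])) (Q.mul_mem_left _ (g3 ![0, 1, 3] ![0, 1, 6]))) (Q.mul_mem_left _ (g3 ![0, 1, 3] ![0, 2, 5])))
  have m40 : x ^ 2 * u * t * z ∈ Q := by
    have e : x ^ 2 * u * t * z = 1 * (x ^ 2 * (W.submatrix ![0, 1, 2] ![0, 4, 6]).det) + 2 * (0) := by
      subst hW; simp [Matrix.det_fin_three]; ring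
    rw [e, h2, zero_mul, add_zero]; exact (Q.mul_mem_left _ (g3 ![0, 1, 2] ![0, 4, 6]))
  have m41 : x ^ 2 * u * t * t ∈ Q := by
    have e : x ^ 2 * u * t * t = 1 * (x ^ 2 * (W.submatrix ![0, 1, 2] ![2, 5, 6]).det) + 2 * (0) := by
      subst hW; simp [Matrix.det_fin_three]; ring
    rw [e, h2, zero_mul, add_zero]; exact (Q.mul_mem_left _ (g3 ![0, 1, 2] ![2, 5, 6]))
  have m42 : x ^ 2 * u * u * z ∈ Q := by
    have e : x ^ 2 * u * u * z = 1 * (x ^ 2 * (W.submatrix ![0, 1, 3] ![0, 4, 6]).det) + 2 * (0) := by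
      subst hW; simp [Matrix.det_fin_three]; ring
    rw [e, h2, zero_mul, add_zero]; exact (Q.mul_mem_left _ (g3 ![0, 1, 3] ![0, 4, 6]))
  have m43 : x ^ 2 * u * u * t ∈ Q := by
    have e : x ^ 2 * u * u * t = 1 * (x ^ 2 * (W.submatrix ![0, 1, 2] ![2, 4, 6]).det) + 2 * (0) := by
      subst hW; simp [Matrix.det_fin_three]; ring
    rw [e, h2, zero_mul, add_zero]; exact (Q.mul_mem_left _ (g3 ![0, 1, 2] ![2, 4, 6]))
  have m44 : x ^ 2 * u * u * u ∈ Q := by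
    have e : x ^ 2 * u * u * u = 1 * (x ^ 2 * (W.submatrix ![0, 1, 3] ![2, 4, 6]).det) + 2 * (0) := by
      subst hW; simp [Matrix.det_fin_three]; ring
    rw [e, h2, zero_mul, add_zero]; exact (Q.mul_mem_left _ (g3 ![0, 1, 3] ![2, 4, 6]))
  have m45 : x ^ 2 * y * z * z ∈ Q := by
    have e : x ^ 2 * y * z * z = 1 * (x ^ 2 * (W.submatrix ![0, 1, 2] ![0, 1, 4]).det) + t * (x ^ 2 * (W.submatrix ![0, 1, 2] ![1, 5, 6]).det) + 1 * (x ^ 2 * (W.submatrix ![0, 1, 3] ![0, 1, 5]).det) + 1 * (x ^ 2 * (W.submatrix ![0, 2, 3] ![0, 2, 5]).det) + 2 * ((-1) * x ^ 2 * y * z ^ 2 + (-1) * x ^ 2 * y * t ^ 3 + x ^ 2 * y ^ 4) := by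
      subst hW; simp [Matrix.det_fin_three]; ring
    rw [e, h2, zero_mul, add_zero]; exact (Q.add_mem (Q.add_mem (Q.add_mem (Q.mul_mem_left _ (g3 ![0, 1, 2] ![0, 1, 4])) (Q.mul_mem_left _ (g3 ![0, 1, 2] ![1, 5, 6]))) (Q.mul_mem_left _ (g3 ![0, 1, 3] ![0, 1, 5]))) (Q.mul_mem_left _ (g3 ![0, 2, 3] ![0, 2, 5])))
  have m46 : x ^ 2 * y * t * z ∈ Q := by
    have e : x ^ 2 * y * t * z = 1 * (x ^ 2 * (W.submatrix ![0, 1, 2] ![0, 4, 5]).det) + 2 * (x ^ 2 * y * t * z) := by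
      subst hW; simp [Matrix.det_fin_three]; ring
    rw [e, h2, zero_mul, add_zero]; exact (Q.mul_mem_left _ (g3 ![0, 1, 2] ![0, 4, 5]))
  have m47 : x ^ 2 * y * t * t ∈ Q := by
    have e : x ^ 2 * y * t * t = 1 * (x ^ 2 * (W.submatrix ![0, 1, 2] ![1, 5, 6]).det) + 2 * (0) := by
      subst hW; simp [Matrix.det_fin_three]; ring
    rw [e, h2, zero_mul, add_zero]; exact (Q.mul_mem_left _ (g3 ![0, 1, 2] ![1, 5, 6]))
  have m48 : x ^ 2 * y * u * z ∈ Q := by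
    have e : x ^ 2 * y * u * z = 1 * (x ^ 2 * (W.submatrix ![0, 1, 3] ![0, 4, 5]).det) + 2 * (0) := by
      subst hW; simp [Matrix.det_fin_three]; ring
    rw [e, h2, zero_mul, add_zero]; exact (Q.mul_mem_left _ (g3 ![0, 1, 3] ![0, 4, 5]))
  have m49 : x ^ 2 * y * u * t ∈ Q := by
    have e : x ^ 2 * y * u * t = 1 * (x ^ 2 * (W.submatrix ![0, 1, 2] ![1, 4, 6]).det) + 2 * (0) := by
      subst hW; simp [Matrix.det_fin_three]; ring
    rw [e, h2, zero_mul, add_zero]; exact (Q.mul_mem_left _ (g3 ![0, 1, 2] ![1, 4, 6]))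
  have m50 : x ^ 2 * y * u * u ∈ Q := by
    have e : x ^ 2 * y * u * u = 1 * (x ^ 2 * (W.submatrix ![0, 1, 3] ![1, 4, 6]).det) + 2 * (0) := by
      subst hW; simp [Matrix.det_fin_three]; ring
    rw [e, h2, zero_mul, add_zero]; exact (Q.mul_mem_left _ (g3 ![0, 1, 3] ![1, 4, 6]))
  have m51 : x ^ 2 * y * y * z ∈ Q := by
    have e : x ^ 2 * y * y * z = 1 * (x ^ 2 * (W.submatrix ![0, 2, 3] ![0, 4, 5]).det) + 2 * (0) := by
      subst hW; simp [Matrix.det_fin_three]; ring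
    rw [e, h2, zero_mul, add_zero]; exact (Q.mul_mem_left _ (g3 ![0, 2, 3] ![0, 4, 5]))
  have m52 : x ^ 2 * y * y * t ∈ Q := by
    have e : x ^ 2 * y * y * t = 1 * (x ^ 2 * (W.submatrix ![0, 1, 2] ![1, 4, 5]).det) + 2 * (x ^ 2 * y ^ 2 * t) := by
      subst hW; simp [Matrix.det_fin_three]; ring
    rw [e, h2, zero_mul, add_zero]; exact (Q.mul_mem_left _ (g3 ![0, 1, 2] ![1, 4, 5]))
  have m53 : x ^ 2 * y * y * u ∈ Q := by
    have e : x ^ 2 * y * y * u = 1 * (x ^ 2 * (W.submatrix ![0, 1, 3] ![1, 4, 5]).det) + 2 * (0) := by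
      subst hW; simp [Matrix.det_fin_three]; ring
    rw [e, h2, zero_mul, add_zero]; exact (Q.mul_mem_left _ (g3 ![0, 1, 3] ![1, 4, 5]))
  have m54 : x ^ 2 * y * y * y ∈ Q := by
    have e : x ^ 2 * y * y * y = 1 * (x ^ 2 * (W.submatrix ![0, 2, 3] ![1, 4, 5]).det) + 2 * (0) := by
      subst hW; simp [Matrix.det_fin_three]; ring
    rw [e, h2, zero_mul, add_zero]; exact (Q.mul_mem_left _ (g3 ![0, 2, 3] ![1, 4, 5]))
  have m55 : x ^ 2 * x ^ 2 * z * z ∈ Q := by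
    have e : x ^ 2 * x ^ 2 * z * z = u * (x ^ 4 * (W.submatrix ![0, 1] ![2, 4]).det) + 1 * (x ^ 4 * (W.submatrix ![0, 2] ![0, 2]).det) + 2 * (0) := by
      subst hW; simp [Matrix.det_fin_two]; ring
    rw [e, h2, zero_mul, add_zero]; exact (Q.add_mem (Q.mul_mem_left _ (g2 ![0, 1] ![2, 4])) (Q.mul_mem_left _ (g2 ![0, 2] ![0, 2])))
  have m56 : x ^ 2 * x ^ 2 * t * z ∈ Q := by
    have e : x ^ 2 * x ^ 2 * t * z = 1 * (x ^ 4 * (W.submatrix ![0, 1] ![0, 5]).det) + 2 * (0) := by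
      subst hW; simp [Matrix.det_fin_two]; ring
    rw [e, h2, zero_mul, add_zero]; exact (Q.mul_mem_left _ (g2 ![0, 1] ![0, 5]))
  have m57 : x ^ 2 * x ^ 2 * t * t ∈ Q := by
    have e : x ^ 2 * x ^ 2 * t * t = 1 * (x ^ 4 * (W.submatrix ![0, 1] ![3, 5]).det) + 2 * (0) := by
      subst hW; simp [Matrix.det_fin_two]; ring
    rw [e, h2, zero_mul, add_zero]; exact (Q.mul_mem_left _ (g2 ![0, 1] ![3, 5]))
  have m58 : x ^ 2 * x ^ 2 * u * z ∈ Q := by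
    have e : x ^ 2 * x ^ 2 * u * z = 1 * (x ^ 4 * (W.submatrix ![0, 1] ![0, 4]).det) + 2 * (0) := by
      subst hW; simp [Matrix.det_fin_two]; ring
    rw [e, h2, zero_mul, add_zero]; exact (Q.mul_mem_left _ (g2 ![0, 1] ![0, 4]))
  have m59 : x ^ 2 * x ^ 2 * u * t ∈ Q := by
    have e : x ^ 2 * x ^ 2 * u * t = 1 * (x ^ 4 * (W.submatrix ![0, 1] ![2, 5]).det) + 2 * (0) := by
      subst hW; simp [Matrix.det_fin_two]; ring
    rw [e, h2, zero_mul, add_zero]; exact (Q.mul_mem_left _ (g2 ![0, 1] ![2, 5]))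
  have m60 : x ^ 2 * x ^ 2 * u * u ∈ Q := by
    have e : x ^ 2 * x ^ 2 * u * u = 1 * (x ^ 4 * (W.submatrix ![0, 1] ![2, 4]).det) + 2 * (0) := by
      subst hW; simp [Matrix.det_fin_two]; ring
    rw [e, h2, zero_mul, add_zero]; exact (Q.mul_mem_left _ (g2 ![0, 1] ![2, 4]))
  have m61 : x ^ 2 * x ^ 2 * y * z ∈ Q := by
    have e : x ^ 2 * x ^ 2 * y * z = 1 * (x ^ 4 * (W.submatrix ![0, 2] ![0, 4]).det) + 2 * (0) := by
      subst hW; simp [Matrix.det_fin_two]; ring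
    rw [e, h2, zero_mul, add_zero]; exact (Q.mul_mem_left _ (g2 ![0, 2] ![0, 4]))
  have m62 : x ^ 2 * x ^ 2 * y * t ∈ Q := by
    have e : x ^ 2 * x ^ 2 * y * t = 1 * (x ^ 4 * (W.submatrix ![0, 1] ![1, 5]).det) + 2 * (0) := by
      subst hW; simp [Matrix.det_fin_two]; ring
    rw [e, h2, zero_mul, add_zero]; exact (Q.mul_mem_left _ (g2 ![0, 1] ![1, 5]))
  have m63 : x ^ 2 * x ^ 2 * y * u ∈ Q := by
    have e : x ^ 2 * x ^ 2 * y * u = 1 * (x ^ 4 * (W.submatrix ![0, 1] ![1, 4]).det) + 2 * (0) := by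
      subst hW; simp [Matrix.det_fin_two]; ring
    rw [e, h2, zero_mul, add_zero]; exact (Q.mul_mem_left _ (g2 ![0, 1] ![1, 4]))
  have m64 : x ^ 2 * x ^ 2 * y * y ∈ Q := by
    have e : x ^ 2 * x ^ 2 * y * y = 1 * (x ^ 4 * (W.submatrix ![0, 2] ![1, 4]).det) + 2 * (0) := by
      subst hW; simp [Matrix.det_fin_two]; ring
    rw [e, h2, zero_mul, add_zero]; exact (Q.mul_mem_left _ (g2 ![0, 2] ![1, 4]))
  have m65 : x ^ 2 * x ^ 2 * x ^ 2 * z ∈ Q := by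
    have e : x ^ 2 * x ^ 2 * x ^ 2 * z = x ^ 6 * W 0 0 := by rw [hW]; simp; ring
    rw [e]; exact g1 0 0
  have m66 : x ^ 2 * x ^ 2 * x ^ 2 * t ∈ Q := by
    have e : x ^ 2 * x ^ 2 * x ^ 2 * t = x ^ 6 * W 0 3 := by rw [hW]; simp; ring
    rw [e]; exact g1 0 3
  have m67 : x ^ 2 * x ^ 2 * x ^ 2 * u ∈ Q := by
    have e : x ^ 2 * x ^ 2 * x ^ 2 * u = x ^ 6 * W 0 2 := by rw [hW]; simp; ring
    rw [e]; exact g1 0 2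
  have m68 : x ^ 2 * x ^ 2 * x ^ 2 * y ∈ Q := by
    have e : x ^ 2 * x ^ 2 * x ^ 2 * y = x ^ 6 * W 0 1 := by rw [hW]; simp; ring
    rw [e]; exact g1 0 1
  have m69 : x ^ 2 * x ^ 2 * x ^ 2 * x ^ 2 ∈ Q := by
    have e : x ^ 2 * x ^ 2 * x ^ 2 * x ^ 2 = x ^ 8 := by ring
    rw [e]; exact gx8
  -- every product of four generators is, up to associativity/commutativity, one of the seventy raw products above
  simp only [mul_comm, mul_left_comm] at m0 m1 m2 m3 m4 m5 m6 m7 m8 m9 m10 m11 m12 m13 m14 m15 m16 m17 m18 m19 m20 m21 m22 m23 m24 m25 m26 m27 m28 m29 m30 m31 m32 m33 m34 m35 m36 m37 m38 m39 m40 m41 m42 m43 m44 m45 m46 m47 m48 m49 m50 m51 m52 m53 m54 m55 m56 m57 m58 m59 m60 m61 m62 m63 m64 m65 m66 m67 m68 m69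
  have key : ∀ i j k l : Fin 5,
      ![x ^ 2, y, u, t, z] i * ![x ^ 2, y, u, t, z] j * ![x ^ 2, y, u, t, z] k * ![x ^ 2, y, u, t, z] l ∈ Q := by
    intro i j k l
    fin_cases i <;> fin_cases j <;> fin_cases k <;> fin_cases l <;>
      simp only [cons_val_zero, cons_val_one, cons_val, Fin.isValue, Fin.mk_one, Fin.zero_eta,
        Fin.reduceFinMk, mul_comm, mul_assoc, mul_left_comm] <;> assumption
  have hT : ({x ^ 2, y, u, t, z} : Set R) = Set.range ![x ^ 2, y, u, t, z] := by
    simp only [range_cons, range_empty, Set.union_empty, Set.singleton_union]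
  have h4 : Ideal.span ({x ^ 2, y, u, t, z} : Set R) ^ 4 =
      Ideal.span ({x ^ 2, y, u, t, z} : Set R) * Ideal.span ({x ^ 2, y, u, t, z} : Set R) * Ideal.span ({x ^ 2, y, u, t, z} : Set R) *
        Ideal.span ({x ^ 2, y, u, t, z} : Set R) := by
    rw [pow_succ, pow_succ, pow_two]
  rw [h4, Ideal.span_mul_span', Ideal.span_mul_span', Ideal.span_mul_span']
  refine Ideal.span_le.mpr ?_
  rintro _ ⟨_, ⟨_, ⟨a, ha, b, hb, rfl⟩, c, hc, rfl⟩, d, hd, rfl⟩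
  rw [hT] at ha hb hc hd
  obtain ⟨i, rfl⟩ := ha
  obtain ⟨j, rfl⟩ := hb
  obtain ⟨k, rfl⟩ := hc
  obtain ⟨l, rfl⟩ := hd
  exact key i j k l

end Summit.ResolutionOfSingularities.ResolutionOfSingularities.Theorems.FInjectiveMacaulayfication.NormBlockCerts
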